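import Summits.BirchSwinnertonDyer.BirchSwinnertonDyer.Theorems.CumulativeHeegnerLeopoldtCumulativeHeegnerInclusionAtThreeVanishingDoor
import Summits.BirchSwinnertonDyer.BirchSwinnertonDyer.Theorems.CumulativeHeegnerLeopoldtCumulativeHeegnerInclusionAtThreeBaseSelmerCount
import Summits.BirchSwinnertonDyer.BirchSwinnertonDyer.Theorems.UniversalToricDescentTwinSplitUnitPairSelmerHalf
import Literature.NumberTheory.EllipticCurves.LocalTorsionAdditiveReductionPPrimaryProofs
import HarnessLib

/-!
# Crux K1 `CumulativeHeegnerInclusionAtThree` (stmt-BirchSwinnertonDyer-24198) / crux A (26896): the VANISHING DOOR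
# made NUMERIC — on the Leopoldt cell, K1's and A's conclusions hold at every rank-one datum `(E, K, P)` with
# `Ш(E/K)[3^∞] = 0`, `3 ∤ ∏_w c_w(E/K)`, `3 ∤ [E(K):ℤP]` and `log_ω P ∈ ℤ₃^×` (unit `𝔭′`-adic logarithm)

Width seat bsd-line-chl-k1-p1-w2 g7 (`--supports stmt-BirchSwinnertonDyer-24198`); composition of the seat's
`…VanishingDoor` (p643779: K1/A pointwise from `3 ∤ Tam(E/K)` + `Sel_{𝔭′}(K, E[3^∞]) = 0`) and `…BaseSelmerCount` (p644630:
X11b's exact count of `Sel_𝔭(K, E[p^∞])` at a rank-one datum WITHOUT `Irr`, any reduction type). Theorems only: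

* §1 `exists_fixed_geomTorsion_of_point_self` (generic `E/K`: a `K`-rational `n`-torsion point `≠ O` gives a non-zero
  `Γ_K`-fixed point of `E(K̄)[n]` — the case `F = K` of `X11b.Transvection.exists_fixed_geomTorsion_of_point`) and
  `cell_forall_torsion_eq_zero` — **`E(K)[3] = 0` on the Leopoldt cell in the currency of `K`-rational points** (the
  hypothesis replacing `Irr` in `…BaseSelmerCount`), from -w2's `cell_geomTorsion_eq_zero_of_fixed_decomp`.
* §2 `cell_reductionPointCount` (`#Ẽ_ns(𝔽₃) = 3`: additive) and **`cell_natCard_selmerAcBase_mul_eq`** — the exact count ON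
  THE CELL: `#Sel_{𝔭′}(K,E[3^∞])·#E(ℚ₃)[3^∞] = 3^a`, `a = ord₃ #Ш[3^∞] + 2(ord₃ log_ω P − ord₃[E(K):ℤP]) + ord₃ ∏_{w∣3} c_w`
  (the anomalous term `ord₃ #Ẽ_ns(𝔽₃) = 1` cancels the `−1`), for any degree-one `𝔭′ ∣ 3`, `rank E(K) = 1`,
  `Ш(E/K)[3^∞]` finite, `P ∈ E(K)` non-torsion.
* §3 **`cell_selmerAcBase_eq_bot_of_numerics`**: `Ш(E/K)[3^∞] = 0`, `3 ∤ ∏_{w∣3} c_w`, `3 ∤ [E(K):ℤP]`, `ord₃ log_ω P = 0`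
  ⟹ `Sel_{𝔭′}(K, E[3^∞]) = 0`.
* §4 **`cumulativeHeegnerInclusionAtThree_pointwise_of_numerics`** / **`temperedHeegnerInclusionAtThree_pointwise_of_numerics`**:
  on that NUMERIC sub-cell (with `3 ∤ ∏_w c_w(E/K)`), for every `ℤ₃`-extension `κ`, generator `γ` and EVERY
  `L : UnrSeries 3`, the conclusions of K1 and of A verbatim (`Ch_Λ X_{∅,0}(𝔭′) = Λ`).

READING (numbers, not adjectives). `ord₃ log_ω P = 0` — a UNIT logarithm — is impossible at a good non-anomalous or a
multiplicative `3` (there `log_ω E(ℚ₃) ⊆ 3ℤ₃`) and possible here exactly because `3 ∣ N` is additive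
(`E₀/E₁ ≅ Ẽ_ns(𝔽₃) = 𝔾_a(𝔽₃) ≅ ℤ/3`, `E₁ ≅ 3ℤ₃` by the integral logarithm at an additive prime): it says `P` generates
`E(ℚ₃) ⊗ ℤ₃` topologically. For the Heegner point `P = y_K` this is the conclusion of the PRINTED `T = 0` theorem of
Kriz–Li (Forum Math. Sigma 7 (2019) e15, Thm. 1.20 / 7.1) under its Bernoulli-unit hypotheses — whose hypothesis (1)
«`ψ(p) ≠ 1 ∧ (ψ⁻¹ω)(p) ≠ 1`» IS the non-anomalous clause of this cell and which allows `p ∣ N`. So on the sub-cell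
{`Ш(E/K)[3] = 0`, `3 ∤ Tam(E/K)·[E(K):ℤ y_K]`, Kriz–Li's congruence conditions} crux K1 and crux A hold by VANISHING
(`X_{∅,0}(𝔭′)` has unit characteristic ideal), with no Kolyvagin system, no reciprocity law and no `L`-function input;
the research content of A (census A26896-LINE-CENSUS-g6 §2) is the complement `n ≥ 1`. CONDITIONAL exactly like X11b /
UTD tier U on the two cited cohomological named facts `poitouTate_selmerStructure_duality K` (Milne ADT I 4.10(b)) and
`localEulerPoincareCharacteristic (K_v)` (I 2.8), taken as hypotheses. Closes nothing by itself (K1/A quantify over the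
whole cell). No definition, no named fact, no `sorry`; imports no `Theses` module. BSD is not proved by any of this; no
summit statement is proved by this seat; K1 24198 and A 26896 stay OPEN.

References: [JetchevSkinnerWan2017] Prop. 3.2.1, (7.1.5); [Castella2018] Thm. 2.3; [Castella2018Erratum] Thm. 1.1 (iv);
[GreenbergLNM1716] §3–§4; [MilneADT2006] I 4.10(b), 2.8; [KrizLi2019] Thm. 1.20; [SilvermanAEC2009] VII.6.1, VIII.§1.
-/

set_option linter.dupNamespace false
set_option autoImplicit false

noncomputable section

open scoped Classical

open NumberField IsDedekindDomain Field WeierstrassCurve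
open Literature.NumberTheory.EllipticCurves Literature.NumberTheory.EllipticCurves.GreenbergSelmer
open Literature.NumberTheory.GaloisRepresentations Literature.NumberTheory.GaloisCohomology

namespace Summit.BirchSwinnertonDyer.BirchSwinnertonDyer.Theorems.CumulativeHeegnerInclusionAtThreeVanishingDoorNumeric

open Summit.BirchSwinnertonDyer.Rank1Residual.X11b
open Summit.BirchSwinnertonDyer.Rank1Residual.X11b.AcSelmer
open Summit.BirchSwinnertonDyer.Rank1Residual.X11b.Halves
open Summit.BirchSwinnertonDyer.BirchSwinnertonDyer.Theorems.CumulativeHeegnerInclusionAtThreeCellNoThreeTorsion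
open Summit.BirchSwinnertonDyer.BirchSwinnertonDyer.Theorems.CumulativeHeegnerInclusionAtThreeVanishingDoor
open Summit.BirchSwinnertonDyer.BirchSwinnertonDyer.Theorems.CumulativeHeegnerInclusionAtThreeBaseSelmerCount
open Summit.BirchSwinnertonDyer.BirchSwinnertonDyer.Theorems.UniversalToricDescentTwinSplit.VanishingControl

/-! ## §1 `E(K)[3] = 0` on the cell, in the currency of `K`-rational points -/

/-- **A `K`-rational `n`-torsion point gives a `Γ_K`-fixed geometric `n`-torsion point** (the case `F = K` of
`X11b.Transvection.exists_fixed_geomTorsion_of_point`): for `E/K` and `P ∈ E(K)` with `n • P = O`, `P ≠ O`, the image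
of `P` in `E(K̄)[n]` is non-zero and fixed by every `σ ∈ Gal(K̄/K)`. [cite: SilvermanAEC2009, VIII.§1 (Galois action on points)] -/
theorem exists_fixed_geomTorsion_of_point_self {K : Type} [Field K] (E : WeierstrassCurve K) {n : ℤ}
    (P : E.toAffine.Point) (hP : n • P = 0) (hP0 : P ≠ 0) :
    ∃ Q : geomTorsion E n, Q ≠ 0 ∧ ∀ σ : absoluteGaloisGroup K, σ • Q = Q := by
  -- `E.baseChange K = E.map (RingHom.id K)` is `E` definitionally (structure eta)
  let P' : (E.baseChange K).toAffine.Point := P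
  have hP' : n • P' = 0 := hP
  have hP'0 : P' ≠ 0 := hP0
  let ι : K →ₐ[K] AlgebraicClosure K := Algebra.ofId K (AlgebraicClosure K)
  let Pbar : geomPoints E := Affine.Point.map ι P'
  have hPbar0 : Pbar ≠ 0 := by
    intro h
    apply hP'0
    apply Affine.Point.map_injective ι
    change Pbar = Affine.Point.map ι 0
    rw [h, map_zero]
    rfl
  have hPbar_tors : Pbar ∈ geomTorsion E n := by
    change n • Affine.Point.map ι P' = 0
    rw [← map_zsmul, hP', map_zero]
  refine ⟨⟨Pbar, hPbar_tors⟩, fun h => hPbar0 (congrArg Subtype.val h), fun σ => ?_⟩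
  apply Subtype.ext
  rw [Literature.NumberTheory.EllipticCurves.AddSubgroup.torsionBy.coe_smul]
  have hcomp : ((show AlgebraicClosure K ≃ₐ[K] AlgebraicClosure K from σ) :
      AlgebraicClosure K →ₐ[K] AlgebraicClosure K).comp ι = ι := Subsingleton.elim _ _
  change Affine.Point.map ((show AlgebraicClosure K ≃ₐ[K] AlgebraicClosure K from σ) :
      AlgebraicClosure K →ₐ[K] AlgebraicClosure K) (Affine.Point.map ι P') = Affine.Point.map ι P'
  rw [Affine.Point.map_map, hcomp]

/-- **`E(K)[3] = 0` on the Leopoldt cell, in the currency of `K`-rational points** (`∀ x ∈ E(K), 3x = O → x = O`):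
a non-zero `3`-torsion point would give a non-zero point of `E_K[3]` fixed by `Γ_K ⊇ D_{𝔭′}`, contradicting
`cell_geomTorsion_eq_zero_of_fixed_decomp` (the non-anomalous clause transported to the degree-one prime `𝔭′ ∋ 3`).
This is the hypothesis that replaces `Irr W 3` in `…BaseSelmerCount`. [cite: Castella2018Erratum, Lemma 2.1]
[cite: GreenbergVatsal2000, §2 p. 28] -/
theorem cell_forall_torsion_eq_zero :
    ∀ (W : WeierstrassCurve ℚ) [W.IsElliptic] [W.IsGloballyMinimal] (N : ℕ) [NeZero N] (K : Type) [Field K]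
      [NumberField K], Summit.BirchSwinnertonDyer.Rank1Residual.Additive.ClassO6 W 3 →
      (∃ Φ : AddSubgroup (WeierstrassCurve.geomTorsion W ((3 : ℕ) : ℤ)),
        Literature.NumberTheory.EllipticCurves.Rank1Residual.IsRationalLine W 3 Φ ∧
        ∀ (v : IsDedekindDomain.HeightOneSpectrum (NumberField.RingOfIntegers ℚ)),
          ((3 : ℕ) : NumberField.RingOfIntegers ℚ) ∈ v.asIdeal → ∀ 𝔓 ∈ v.primesAbove,
          ¬ (∀ g ∈ 𝔓.decompositionSubgroup (Field.absoluteGaloisGroup ℚ), ∀ P ∈ Φ, g • P = P) ∧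
          ¬ (∀ g ∈ 𝔓.decompositionSubgroup (Field.absoluteGaloisGroup ℚ),
              ∀ P : WeierstrassCurve.geomTorsion W ((3 : ℕ) : ℤ), g • P - P ∈ Φ)) →
      W.conductorNorm ℤ = N → Literature.NumberTheory.EllipticCurves.IsImaginaryQuadratic K →
      Literature.NumberTheory.EllipticCurves.SatisfiesHeegnerHypothesis N K →
      ∀ (𝔭' : IsDedekindDomain.HeightOneSpectrum (NumberField.RingOfIntegers K)),
        ((3 : ℕ) : NumberField.RingOfIntegers K) ∈ 𝔭'.asIdeal →
      ∀ x : (W.baseChange K).toAffine.Point, 3 • x = 0 → x = 0 := by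
  intro W _ _ N _ K _ _ hO6 hline hN hK hHg 𝔭' h𝔭' x hx
  by_contra hx0
  obtain ⟨Q, hQ0, hfix⟩ := exists_fixed_geomTorsion_of_point_self (W.baseChange K) x
    (show (((3 : ℕ) : ℤ)) • x = 0 by rw [natCast_zsmul]; exact hx) hx0
  exact hQ0 (cell_geomTorsion_eq_zero_of_fixed_decomp W N K hO6 hline hN hK hHg 𝔭' h𝔭' Q
    fun g _ ↦ hfix g)


/-! ## §2 The exact base Selmer count ON THE CELL -/

/-- Additive `3`: `#Ẽ_ns(𝔽₃) = 3` (the anomalous term of the count is `ord₃ 3 = 1`). [cite: SilvermanAEC2009, VII.6.1 / III.2.5] -/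
theorem cell_reductionPointCount (W : WeierstrassCurve ℚ) [W.IsElliptic] [W.IsGloballyMinimal]
    (hO6 : Summit.BirchSwinnertonDyer.Rank1Residual.Additive.ClassO6 W 3) :
    haveI : Fact (Nat.Prime 3) := ⟨Nat.prime_three⟩
    reductionPointCount W 3 = 3 := by
  haveI : Fact (Nat.Prime 3) := ⟨Nat.prime_three⟩
  exact reductionPointCount_of_additive W 3 hO6.2.1.1 hO6.2.1.2

/-- **The exact count of Castella's Selmer group over `K` on the Leopoldt cell.** On the cell (class O6 at `3`,
non-anomalous rational line, `N = N_E`, `K` imaginary quadratic Heegner for `N`), for a degree-one prime `𝔭′ ∋ 3` of `K`,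
`rank E(K) = 1`, `Ш(E/K)[3^∞]` finite and `P ∈ E(K)` non-torsion:
`#Sel_{𝔭′}(K,E[3^∞])·#E(ℚ₃)[3^∞] = 3^a` with `a = ord₃ #Ш[3^∞] + 2(ord₃ log_ω P − ord₃[E(K):ℤP]) + ord₃ ∏_{w∣3} c_w(E/K)`
EXACTLY (`…BaseSelmerCount.natCard_selmerAcBase_mul_eq_of_rankOne_primary_noTorsion` with `E(K)[3] = 0` from §1,
`3` split from the Heegner hypothesis, and `ord₃ #Ẽ_ns(𝔽₃) = 1`). CONDITIONAL on the two cited cohomological facts.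
[cite: JetchevSkinnerWan2017, Prop. 3.2.1 and (7.1.5)] [cite: Castella2018, Thm. 2.3 and proof]
[cite: MilneADT2006, Ch. I, Thm. 4.10(b) and Thm. 2.8] -/
theorem cell_natCard_selmerAcBase_mul_eq :
    ∀ (W : WeierstrassCurve ℚ) [W.IsElliptic] [W.IsGloballyMinimal] (N : ℕ) [NeZero N] (K : Type) [Field K]
      [NumberField K], Summit.BirchSwinnertonDyer.Rank1Residual.Additive.ClassO6 W 3 →
      (∃ Φ : AddSubgroup (WeierstrassCurve.geomTorsion W ((3 : ℕ) : ℤ)),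
        Literature.NumberTheory.EllipticCurves.Rank1Residual.IsRationalLine W 3 Φ ∧
        ∀ (v : IsDedekindDomain.HeightOneSpectrum (NumberField.RingOfIntegers ℚ)),
          ((3 : ℕ) : NumberField.RingOfIntegers ℚ) ∈ v.asIdeal → ∀ 𝔓 ∈ v.primesAbove,
          ¬ (∀ g ∈ 𝔓.decompositionSubgroup (Field.absoluteGaloisGroup ℚ), ∀ P ∈ Φ, g • P = P) ∧
          ¬ (∀ g ∈ 𝔓.decompositionSubgroup (Field.absoluteGaloisGroup ℚ),
              ∀ P : WeierstrassCurve.geomTorsion W ((3 : ℕ) : ℤ), g • P - P ∈ Φ)) →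
      W.conductorNorm ℤ = N → Literature.NumberTheory.EllipticCurves.IsImaginaryQuadratic K →
      Literature.NumberTheory.EllipticCurves.SatisfiesHeegnerHypothesis N K →
      poitouTate_selmerStructure_duality K →
      (∀ v : HeightOneSpectrum (𝓞 K), localEulerPoincareCharacteristic (v.adicCompletion K)) →
      ∀ (𝔭' : IsDedekindDomain.HeightOneSpectrum (NumberField.RingOfIntegers K))
        (h𝔭' : ((3 : ℕ) : NumberField.RingOfIntegers K) ∈ 𝔭'.asIdeal)
        (he' : 𝔭'.asIdeal.ramificationIdx (𝓞 ℚ) = 1) (hf' : 𝔭'.asIdeal.inertiaDeg (𝓞 ℚ) = 1),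
      (W.baseChange K).mordellWeilRank = 1 →
      Finite (AddCommGroup.primaryComponent (W.baseChange K).sha 3) →
      ∀ (P : (W.baseChange K).toAffine.Point), ¬ IsOfFinAddOrder P →
      haveI : Fact (Nat.Prime 3) := ⟨Nat.prime_three⟩
      ∃ (_ : Finite (selmerAcBase (W.baseChange K) 3 𝔭' ∅)) (a : ℕ),
        Nat.card (selmerAcBase (W.baseChange K) 3 𝔭' ∅) *
            Nat.card (AddCommGroup.primaryComponent (W.baseChange ℚ_[3]).toAffine.Point 3) = 3 ^ a ∧
        (a : ℤ) =
          (padicValNat 3 (Nat.card (AddCommGroup.primaryComponent (W.baseChange K).sha 3)) : ℤ) +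
          2 * (Summit.BirchSwinnertonDyer.Rank1Residual.X11b.padicLogOrd W 3 (embAt K 3 𝔭' h𝔭' he' hf') P -
            (padicValNat 3 (AddSubgroup.zmultiples P).index : ℤ)) +
            padicValNat 3 (tamagawaProductAbove W K 3) := by
  intro W _ _ N _ K _ _ hO6 hline hN hK hHg hPT hEP 𝔭' h𝔭' he' hf' hrank hSha P hPinf
  haveI : Fact (Nat.Prime 3) := ⟨Nat.prime_three⟩
  have h3N : 3 ∣ N := by
    rw [← hN]
    exact (W.dvd_conductorNorm_iff_not_hasGoodReductionAtPrime 3).mpr hO6.2.1.1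
  have hsplit : SplitsIn K 3 := hHg 3 Nat.prime_three h3N
  have hivK := cell_forall_torsion_eq_zero W N K hO6 hline hN hK hHg 𝔭' h𝔭'
  obtain ⟨hfin, a, hcard, ha⟩ := natCard_selmerAcBase_mul_eq_of_rankOne_primary_noTorsion W 3 K hPT hEP
    hivK hK hsplit hrank hSha P hPinf 𝔭' h𝔭' he' hf'
  refine ⟨hfin, a, hcard, ?_⟩
  rw [ha, cell_reductionPointCount W hO6]
  simp

/-! ## §3 The vanishing of Castella's Selmer group over `K` from four numerics -/

/-- **`Sel_{𝔭′}(K, E[3^∞]) = 0` on the Leopoldt cell from four numerics**: `Ш(E/K)[3^∞] = 0`, `3 ∤ ∏_{w∣3} c_w(E/K)`,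
`3 ∤ [E(K):ℤP]` and `ord₃ log_ω P = 0` (unit logarithm at `𝔭′`) at a non-torsion `P ∈ E(K)` with `rank E(K) = 1`.
CONDITIONAL on the two cited cohomological facts. [cite: JetchevSkinnerWan2017, Prop. 3.2.1 and (7.1.5)]
[cite: MilneADT2006, Ch. I, Thm. 4.10(b) and Thm. 2.8] -/
theorem cell_selmerAcBase_eq_bot_of_numerics :
    ∀ (W : WeierstrassCurve ℚ) [W.IsElliptic] [W.IsGloballyMinimal] (N : ℕ) [NeZero N] (K : Type) [Field K]
      [NumberField K], Summit.BirchSwinnertonDyer.Rank1Residual.Additive.ClassO6 W 3 →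
      (∃ Φ : AddSubgroup (WeierstrassCurve.geomTorsion W ((3 : ℕ) : ℤ)),
        Literature.NumberTheory.EllipticCurves.Rank1Residual.IsRationalLine W 3 Φ ∧
        ∀ (v : IsDedekindDomain.HeightOneSpectrum (NumberField.RingOfIntegers ℚ)),
          ((3 : ℕ) : NumberField.RingOfIntegers ℚ) ∈ v.asIdeal → ∀ 𝔓 ∈ v.primesAbove,
          ¬ (∀ g ∈ 𝔓.decompositionSubgroup (Field.absoluteGaloisGroup ℚ), ∀ P ∈ Φ, g • P = P) ∧
          ¬ (∀ g ∈ 𝔓.decompositionSubgroup (Field.absoluteGaloisGroup ℚ),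
              ∀ P : WeierstrassCurve.geomTorsion W ((3 : ℕ) : ℤ), g • P - P ∈ Φ)) →
      W.conductorNorm ℤ = N → Literature.NumberTheory.EllipticCurves.IsImaginaryQuadratic K →
      Literature.NumberTheory.EllipticCurves.SatisfiesHeegnerHypothesis N K →
      poitouTate_selmerStructure_duality K →
      (∀ v : HeightOneSpectrum (𝓞 K), localEulerPoincareCharacteristic (v.adicCompletion K)) →
      ∀ (𝔭' : IsDedekindDomain.HeightOneSpectrum (NumberField.RingOfIntegers K))
        (h𝔭' : ((3 : ℕ) : NumberField.RingOfIntegers K) ∈ 𝔭'.asIdeal)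
        (he' : 𝔭'.asIdeal.ramificationIdx (𝓞 ℚ) = 1) (hf' : 𝔭'.asIdeal.inertiaDeg (𝓞 ℚ) = 1),
      (W.baseChange K).mordellWeilRank = 1 →
      AddCommGroup.primaryComponent (W.baseChange K).sha 3 = ⊥ →
      ∀ (P : (W.baseChange K).toAffine.Point), ¬ IsOfFinAddOrder P →
      ¬ 3 ∣ (AddSubgroup.zmultiples P).index →
      haveI : Fact (Nat.Prime 3) := ⟨Nat.prime_three⟩
      Summit.BirchSwinnertonDyer.Rank1Residual.X11b.padicLogOrd W 3 (embAt K 3 𝔭' h𝔭' he' hf') P = 0 →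
      ¬ 3 ∣ tamagawaProductAbove W K 3 →
      selmerAcBase (W.baseChange K) 3 𝔭' ∅ = ⊥ := by
  intro W _ _ N _ K _ _ hO6 hline hN hK hHg hPT hEP 𝔭' h𝔭' he' hf' hrank hSha P hPinf hidx hlog htam3
  haveI : Fact (Nat.Prime 3) := ⟨Nat.prime_three⟩
  have hShafin : Finite (AddCommGroup.primaryComponent (W.baseChange K).sha 3) := by
    rw [hSha]; infer_instance
  obtain ⟨hfin, a, hcard, ha⟩ := cell_natCard_selmerAcBase_mul_eq W N K hO6 hline hN hK hHg hPT hEP 𝔭' h𝔭'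
    he' hf' hrank hShafin P hPinf
  have h1 : padicValNat 3 (Nat.card (AddCommGroup.primaryComponent (W.baseChange K).sha 3)) = 0 := by
    rw [hSha, AddSubgroup.card_bot]; simp
  have h2 : padicValNat 3 (AddSubgroup.zmultiples P).index = 0 := padicValNat.eq_zero_of_not_dvd hidx
  have h3 : padicValNat 3 (tamagawaProductAbove W K 3) = 0 := padicValNat.eq_zero_of_not_dvd htam3
  rw [h1, h2, h3, hlog] at ha
  have ha0 : a = 0 := by push_cast at ha; omega
  haveI := hfin
  haveI : Finite (AddCommGroup.primaryComponent (W.baseChange ℚ_[3]).toAffine.Point 3) :=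
    Nat.finite_of_card_ne_zero (by
      intro h0
      rw [h0, mul_zero, ha0, pow_zero] at hcard
      exact zero_ne_one hcard)
  rw [ha0] at hcard
  exact selmerAcBase_eq_bot_of_count_zero (W.baseChange K) 3 𝔭' _ hcard

/-! ## §4 Pointwise K1 / A on the numeric sub-cell -/

/-- **Pointwise K1 from four numerics.** On the Leopoldt cell, at a rank-one datum `(E, K, P)` and a degree-one
`𝔭′ ∋ 3` with `Ш(E/K)[3^∞] = 0`, `3 ∤ ∏_w c_w(E/K)`, `3 ∤ [E(K):ℤP]` and `ord₃ log_ω P = 0` at `𝔭′`: for every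
`ℤ₃`-extension `κ`, generator `γ` and EVERY `L : UnrSeries 3`,
`span{L} ≤ (XAc.charIdeal (E/K) 3 κ 𝔭′ ∅ γ).map toUnr` — the conclusion of crux K1 `CumulativeHeegnerInclusionAtThree`
verbatim for this datum (via `Ch_Λ X_{∅,0}(𝔭′) = Λ`). CONDITIONAL on the two cited cohomological facts; closes nothing by
itself. [cite: GreenbergLNM1716, §4 Lemma 4.2] [cite: JetchevSkinnerWan2017, Prop. 3.2.1] [cite: KrizLi2019, Thm. 1.20 (source of the unit logarithm)] -/
theorem cumulativeHeegnerInclusionAtThree_pointwise_of_numerics :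
    ∀ (W : WeierstrassCurve ℚ) [W.IsElliptic] [W.IsGloballyMinimal] (N : ℕ) [NeZero N] (K : Type) [Field K]
      [NumberField K], Summit.BirchSwinnertonDyer.Rank1Residual.Additive.ClassO6 W 3 →
      (∃ Φ : AddSubgroup (WeierstrassCurve.geomTorsion W ((3 : ℕ) : ℤ)),
        Literature.NumberTheory.EllipticCurves.Rank1Residual.IsRationalLine W 3 Φ ∧
        ∀ (v : IsDedekindDomain.HeightOneSpectrum (NumberField.RingOfIntegers ℚ)),
          ((3 : ℕ) : NumberField.RingOfIntegers ℚ) ∈ v.asIdeal → ∀ 𝔓 ∈ v.primesAbove,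
          ¬ (∀ g ∈ 𝔓.decompositionSubgroup (Field.absoluteGaloisGroup ℚ), ∀ P ∈ Φ, g • P = P) ∧
          ¬ (∀ g ∈ 𝔓.decompositionSubgroup (Field.absoluteGaloisGroup ℚ),
              ∀ P : WeierstrassCurve.geomTorsion W ((3 : ℕ) : ℤ), g • P - P ∈ Φ)) →
      W.conductorNorm ℤ = N → Literature.NumberTheory.EllipticCurves.IsImaginaryQuadratic K →
      Literature.NumberTheory.EllipticCurves.SatisfiesHeegnerHypothesis N K →
      poitouTate_selmerStructure_duality K →
      (∀ v : HeightOneSpectrum (𝓞 K), localEulerPoincareCharacteristic (v.adicCompletion K)) →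
      ∀ (𝔭' : IsDedekindDomain.HeightOneSpectrum (NumberField.RingOfIntegers K))
        (h𝔭' : ((3 : ℕ) : NumberField.RingOfIntegers K) ∈ 𝔭'.asIdeal)
        (he' : 𝔭'.asIdeal.ramificationIdx (𝓞 ℚ) = 1) (hf' : 𝔭'.asIdeal.inertiaDeg (𝓞 ℚ) = 1),
      (W.baseChange K).mordellWeilRank = 1 →
      AddCommGroup.primaryComponent (W.baseChange K).sha 3 = ⊥ →
      ∀ (P : (W.baseChange K).toAffine.Point), ¬ IsOfFinAddOrder P →
      ¬ 3 ∣ (AddSubgroup.zmultiples P).index →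
      haveI : Fact (Nat.Prime 3) := ⟨Nat.prime_three⟩
      Summit.BirchSwinnertonDyer.Rank1Residual.X11b.padicLogOrd W 3 (embAt K 3 𝔭' h𝔭' he' hf') P = 0 →
      haveI : (W.baseChange K).IsElliptic := inferInstanceAs (W.map (algebraMap ℚ K)).IsElliptic
      ¬ 3 ∣ (W.baseChange K).tamagawaProduct →
      ∀ (κ : Literature.NumberTheory.EllipticCurves.ZpExtension K 3) (γ : Field.absoluteGaloisGroup K)
        [Fact (κ.IsTopGenerator γ)] (L : Literature.NumberTheory.EllipticCurves.UnrSeries 3),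
        Ideal.span {L} ≤ (Summit.BirchSwinnertonDyer.Rank1Residual.X11b.AcSelmer.XAc.charIdeal
          (W.baseChange K) 3 κ 𝔭' ∅ γ).map
            (PowerSeries.map (Summit.BirchSwinnertonDyer.Rank1Residual.X11b.Halves.toUnr 3)) := by
  intro W _ _ N _ K _ _ hO6 hline hN hK hHg hPT hEP 𝔭' h𝔭' he' hf' hrank hSha P hPinf hidx hlog htam κ γ _ L
  haveI : Fact (Nat.Prime 3) := ⟨Nat.prime_three⟩
  have htam3 : ¬ 3 ∣ tamagawaProductAbove W K 3 := fun h ↦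
    htam (h.trans (tamagawaProductAbove_dvd_tamagawaProduct W K 3))
  have hbase := cell_selmerAcBase_eq_bot_of_numerics W N K hO6 hline hN hK hHg hPT hEP 𝔭' h𝔭' he' hf' hrank
    hSha P hPinf hidx hlog htam3
  exact cumulativeHeegnerInclusionAtThree_pointwise_of_atoms W N K hO6 hline hN hK hHg κ γ 𝔭' h𝔭' htam hbase L

/-- **Pointwise A (tempered inclusion, `μ = 0`) from four numerics** — the conclusion shape of crux A
`TemperedHeegnerInclusionAtThree` (stmt-26896) for this datum and every `L`. CONDITIONAL on the two cited cohomological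
facts; closes nothing by itself. [cite: GreenbergLNM1716, §4 Lemma 4.2] [cite: JetchevSkinnerWan2017, Prop. 3.2.1] -/
theorem temperedHeegnerInclusionAtThree_pointwise_of_numerics :
    ∀ (W : WeierstrassCurve ℚ) [W.IsElliptic] [W.IsGloballyMinimal] (N : ℕ) [NeZero N] (K : Type) [Field K]
      [NumberField K], Summit.BirchSwinnertonDyer.Rank1Residual.Additive.ClassO6 W 3 →
      (∃ Φ : AddSubgroup (WeierstrassCurve.geomTorsion W ((3 : ℕ) : ℤ)),
        Literature.NumberTheory.EllipticCurves.Rank1Residual.IsRationalLine W 3 Φ ∧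
        ∀ (v : IsDedekindDomain.HeightOneSpectrum (NumberField.RingOfIntegers ℚ)),
          ((3 : ℕ) : NumberField.RingOfIntegers ℚ) ∈ v.asIdeal → ∀ 𝔓 ∈ v.primesAbove,
          ¬ (∀ g ∈ 𝔓.decompositionSubgroup (Field.absoluteGaloisGroup ℚ), ∀ P ∈ Φ, g • P = P) ∧
          ¬ (∀ g ∈ 𝔓.decompositionSubgroup (Field.absoluteGaloisGroup ℚ),
              ∀ P : WeierstrassCurve.geomTorsion W ((3 : ℕ) : ℤ), g • P - P ∈ Φ)) →
      W.conductorNorm ℤ = N → Literature.NumberTheory.EllipticCurves.IsImaginaryQuadratic K →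
      Literature.NumberTheory.EllipticCurves.SatisfiesHeegnerHypothesis N K →
      poitouTate_selmerStructure_duality K →
      (∀ v : HeightOneSpectrum (𝓞 K), localEulerPoincareCharacteristic (v.adicCompletion K)) →
      ∀ (𝔭' : IsDedekindDomain.HeightOneSpectrum (NumberField.RingOfIntegers K))
        (h𝔭' : ((3 : ℕ) : NumberField.RingOfIntegers K) ∈ 𝔭'.asIdeal)
        (he' : 𝔭'.asIdeal.ramificationIdx (𝓞 ℚ) = 1) (hf' : 𝔭'.asIdeal.inertiaDeg (𝓞 ℚ) = 1),
      (W.baseChange K).mordellWeilRank = 1 →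
      AddCommGroup.primaryComponent (W.baseChange K).sha 3 = ⊥ →
      ∀ (P : (W.baseChange K).toAffine.Point), ¬ IsOfFinAddOrder P →
      ¬ 3 ∣ (AddSubgroup.zmultiples P).index →
      haveI : Fact (Nat.Prime 3) := ⟨Nat.prime_three⟩
      Summit.BirchSwinnertonDyer.Rank1Residual.X11b.padicLogOrd W 3 (embAt K 3 𝔭' h𝔭' he' hf') P = 0 →
      haveI : (W.baseChange K).IsElliptic := inferInstanceAs (W.map (algebraMap ℚ K)).IsElliptic
      ¬ 3 ∣ (W.baseChange K).tamagawaProduct →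
      ∀ (κ : Literature.NumberTheory.EllipticCurves.ZpExtension K 3) (γ : Field.absoluteGaloisGroup K)
        [Fact (κ.IsTopGenerator γ)] (L : Literature.NumberTheory.EllipticCurves.UnrSeries 3),
        ∃ μ : ℕ, Ideal.span {(3 : Literature.NumberTheory.EllipticCurves.UnrSeries 3) ^ μ * L} ≤
          (Summit.BirchSwinnertonDyer.Rank1Residual.X11b.AcSelmer.XAc.charIdeal
            (W.baseChange K) 3 κ 𝔭' ∅ γ).map
              (PowerSeries.map (Summit.BirchSwinnertonDyer.Rank1Residual.X11b.Halves.toUnr 3)) := by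
  intro W _ _ N _ K _ _ hO6 hline hN hK hHg hPT hEP 𝔭' h𝔭' he' hf' hrank hSha P hPinf hidx hlog htam κ γ _ L
  have h := cumulativeHeegnerInclusionAtThree_pointwise_of_numerics W N K hO6 hline hN hK hHg hPT hEP 𝔭' h𝔭'
    he' hf' hrank hSha P hPinf hidx hlog htam κ γ L
  exact ⟨0, by simpa using h⟩

end Summit.BirchSwinnertonDyer.BirchSwinnertonDyer.Theorems.CumulativeHeegnerInclusionAtThreeVanishingDoorNumeric

end
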